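import Literature.Analysis.FunctionSpaces.DiagonalWeakLimits
import Literature.Geometry.Lorentzian.InverseMeanCurvatureFlowCompactness
import HarnessLib

/-!
# Inverse mean curvature flow I — proofs: Arzelà–Ascoli for locally equi-Lipschitz sequences

The extraction step "By the Arzelà–Ascoli theorem, there exists `Lᵢ → ∞`, `εᵢ → 0`, a
subsequence `uᵢ`, and a locally Lipschitz function `u` such that `uᵢ → u` locally uniformly"
of Huisken–Ilmanen's proof of the Weak Existence Theorem 3.1 (J. Differential Geom. 59 (2001),
§3, p. 26), for the setting of this series of files: a sequence `uᵢ : X → ℝ` on a Riemannian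
`3`-manifold which is *locally equi-Lipschitz* for the Riemannian distance on an open set `Ω`
(every point of `Ω` has a neighbourhood on which all `uᵢ` are `K`-Lipschitz — the output of the
gradient estimates through `exists_nhds_forall_lipschitzOnWith_of_gradNorm_le`) and pointwise
bounded has a subsequence converging locally uniformly on `Ω`
(`exists_strictMono_tendstoLocallyUniformlyOn_of_lipschitzOnWith`). Proof: Cantor's diagonal
procedure over a countable dense set (`FunctionSpaces.exists_strictMono_forall_tendsto_real`),
Cauchy sequences at every point by the uniform modulus, and local uniformity again by the modulus
(`|uₙ y − u y| ≤ |uₙ y − uₙ x| + |uₙ x − u x| + |u x − u y| ≤ 2Kη + |uₙ x − u x|`).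

Everything is proved; there are no definitions and no named facts.

## References

* G. Huisken, T. Ilmanen, *The inverse mean curvature flow and the Riemannian Penrose
  inequality*, J. Differential Geom. 59 (2001) 353–437: §3, proof of Thm. 3.1 ("By the
  Arzelà–Ascoli theorem …").
-/

noncomputable section

open Bundle Set Manifold TopologicalSpace Filter Function
open scoped ContDiff Topology ENNReal NNReal Manifold

namespace Literature.Geometry.Lorentzian

variable {X : Type*} [TopologicalSpace X] [ChartedSpace E3 X] [IsManifold (𝓡 3) ∞ X]
  (h : ContMDiffRiemannianMetric (𝓡 3) ∞ E3 (TangentSpace (𝓡 3) : X → Type _))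
  [T2Space X] [LocallyCompactSpace X] [SecondCountableTopology X]

/-- A Lipschitz bound in a pseudo-emetric space, read in `ℝ`: if `f` is `K`-Lipschitz on `V`,
`a, b ∈ V` and `edist a b ≤ η`, then `|f a − f b| ≤ K η`. [folklore] -/
theorem abs_sub_le_of_lipschitzOnWith {α : Type*} [PseudoEMetricSpace α] {f : α → ℝ} {K : ℝ≥0}
    {V : Set α} {a b : α} {η : ℝ} (hf : LipschitzOnWith K f V) (ha : a ∈ V) (hb : b ∈ V)
    (hη : 0 ≤ η) (hab : edist a b ≤ ENNReal.ofReal η) : |f a - f b| ≤ K * η := by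
  have h1 : edist (f a) (f b) ≤ K * ENNReal.ofReal η := (hf ha hb).trans (by gcongr)
  rw [edist_dist, Real.dist_eq, ← ENNReal.ofReal_coe_nnreal, ← ENNReal.ofReal_mul (NNReal.coe_nonneg K)] at h1
  exact (ENNReal.ofReal_le_ofReal_iff (by positivity)).1 h1

set_option backward.isDefEq.respectTransparency false in
/-- **Arzelà–Ascoli for locally equi-Lipschitz, pointwise bounded sequences** on an open subset of
a Riemannian manifold: if every point of the open set `Ω` has a neighbourhood on which all `uᵢ` are
`K`-Lipschitz for the Riemannian distance, and `(uᵢ x)ᵢ` is bounded for each `x ∈ Ω`, then some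
subsequence converges locally uniformly on `Ω`. This is the extraction step of Huisken–Ilmanen's
proof of Thm. 3.1 ("By the Arzelà–Ascoli theorem, there exists … a subsequence `uᵢ`, and a
locally Lipschitz function `u` such that `uᵢ → u` locally uniformly").
[cite: HuiskenIlmanenIMCF2001, §3 proof of Thm. 3.1 (Arzelà–Ascoli)] -/
theorem exists_strictMono_tendstoLocallyUniformlyOn_of_lipschitzOnWith {u : ℕ → X → ℝ} {Ω : Set X}
    (hΩ : IsOpen Ω)
    (hlip : letI : RiemannianBundle (fun x : X ↦ TangentSpace (𝓡 3) x) :=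
        ⟨h.toContinuousRiemannianMetric.toRiemannianMetric⟩
      letI : PseudoEMetricSpace X := .ofRiemannianMetric (𝓡 3) X
      ∀ x ∈ Ω, ∃ K : ℝ≥0, ∃ V ∈ 𝓝 x, ∀ i, LipschitzOnWith K (u i) V)
    (hbdd : ∀ x ∈ Ω, ∃ B : ℝ, ∀ i, |u i x| ≤ B) :
    ∃ (φ : ℕ → ℕ) (U : X → ℝ), StrictMono φ ∧
      TendstoLocallyUniformlyOn (fun n ↦ u (φ n)) U atTop Ω := by
  letI : RiemannianBundle (fun x : X ↦ TangentSpace (𝓡 3) x) :=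
    ⟨h.toContinuousRiemannianMetric.toRiemannianMetric⟩
  letI : PseudoEMetricSpace X := .ofRiemannianMetric (𝓡 3) X
  -- a countable dense set and the diagonal subsequence converging on it
  obtain ⟨D, hDc, hDd⟩ := TopologicalSpace.exists_countable_dense X
  haveI : Countable (D ∩ Ω : Set X) := (hDc.mono inter_subset_left).to_subtype
  obtain ⟨φ, hφ, hconvD⟩ :=
    Literature.Analysis.FunctionSpaces.exists_strictMono_forall_tendsto_real
      (fun n (d : (D ∩ Ω : Set X)) ↦ u n d) (fun d ↦ hbdd d d.2.2)
  -- near every point of `Ω`: a Lipschitz neighbourhood and nearby points of `D`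
  have hnear : ∀ x ∈ Ω, ∀ {K : ℝ≥0} {V : Set X}, V ∈ 𝓝 x → ∀ {η : ℝ}, 0 < η →
      ∃ d, d ∈ V ∧ d ∈ Ω ∧ d ∈ D ∧ edist x d ≤ ENNReal.ofReal η := by
    intro x hx K V hV η hη
    have hopen : IsOpen (interior V ∩ Ω ∩ Metric.eball x (ENNReal.ofReal η)) :=
      (isOpen_interior.inter hΩ).inter Metric.isOpen_eball
    have hxmem : x ∈ interior V ∩ Ω ∩ Metric.eball x (ENNReal.ofReal η) :=
      ⟨⟨mem_interior_iff_mem_nhds.2 hV, hx⟩, Metric.mem_eball_self (by simpa using hη)⟩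
    obtain ⟨d, hdD, ⟨⟨hdV, hdΩ⟩, hdball⟩⟩ := hDd.exists_mem_open hopen ⟨x, hxmem⟩
    refine ⟨d, interior_subset hdV, hdΩ, hdD, ?_⟩
    rw [edist_comm]; exact (Metric.mem_eball.1 hdball).le
  -- the sequence is Cauchy at every point of `Ω`
  have hcauchy : ∀ x ∈ Ω, CauchySeq (fun n ↦ u (φ n) x) := by
    intro x hx
    obtain ⟨K, V, hV, hK⟩ := hlip x hx
    have hxV : x ∈ V := mem_of_mem_nhds hV
    rw [Metric.cauchySeq_iff]
    intro ε hε
    set η : ℝ := ε / (4 * (K + 1)) with hη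
    have hη0 : 0 < η := by positivity
    have hKη : (K : ℝ) * η ≤ ε / 4 := by
      rw [hη, mul_div_assoc', div_le_div_iff₀ (by positivity) (by positivity)]
      nlinarith [NNReal.coe_nonneg K, hε.le]
    obtain ⟨d, hdV, hdΩ, hdD, hxd⟩ := hnear x hx (K := K) hV hη0
    obtain ⟨l, hl⟩ := hconvD ⟨d, hdD, hdΩ⟩
    obtain ⟨N, hN⟩ := Metric.cauchySeq_iff.1 hl.cauchySeq (ε / 2) (half_pos hε)
    refine ⟨N, fun m hm n hn ↦ ?_⟩
    have h1 : |u (φ m) x - u (φ m) d| ≤ K * η :=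
      abs_sub_le_of_lipschitzOnWith (hK (φ m)) hxV hdV hη0.le hxd
    have h2 : |u (φ n) x - u (φ n) d| ≤ K * η :=
      abs_sub_le_of_lipschitzOnWith (hK (φ n)) hxV hdV hη0.le hxd
    have h3 : |u (φ m) d - u (φ n) d| < ε / 2 := by
      have := hN m hm n hn; rwa [Real.dist_eq] at this
    rw [Real.dist_eq]
    calc |u (φ m) x - u (φ n) x|
        ≤ |u (φ m) x - u (φ m) d| + |u (φ m) d - u (φ n) d| + |u (φ n) d - u (φ n) x| := by
          calc |u (φ m) x - u (φ n) x| ≤ |u (φ m) x - u (φ n) d| + |u (φ n) d - u (φ n) x| :=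
                abs_sub_le _ _ _
            _ ≤ |u (φ m) x - u (φ m) d| + |u (φ m) d - u (φ n) d| + |u (φ n) d - u (φ n) x| := by
                gcongr; exact abs_sub_le _ _ _
      _ < ε := by rw [abs_sub_comm (u (φ n) d)]; linarith
  -- the limit function
  have hconv : ∀ x ∈ Ω, ∃ l, Tendsto (fun n ↦ u (φ n) x) atTop (𝓝 l) := fun x hx ↦
    cauchySeq_tendsto_of_complete (hcauchy x hx)
  choose! U hU using hconv
  refine ⟨φ, U, hφ, ?_⟩
  -- locally uniform convergence
  rw [Metric.tendstoLocallyUniformlyOn_iff]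
  intro ε hε x hx
  obtain ⟨K, V, hV, hK⟩ := hlip x hx
  have hxV : x ∈ V := mem_of_mem_nhds hV
  have hUK : LipschitzOnWith K U (V ∩ Ω) :=
    lipschitzOnWith_of_tendsto (Eventually.of_forall fun n ↦ (hK (φ n)).mono inter_subset_left)
      fun y hy ↦ hU y hy.2
  set η : ℝ := ε / (4 * (K + 1)) with hη
  have hη0 : 0 < η := by positivity
  have hKη : (K : ℝ) * η ≤ ε / 4 := by
    rw [hη, mul_div_assoc', div_le_div_iff₀ (by positivity) (by positivity)]
    nlinarith [NNReal.coe_nonneg K, hε.le]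
  refine ⟨V ∩ Ω ∩ Metric.eball x (ENNReal.ofReal η), mem_nhdsWithin_of_mem_nhds
    (inter_mem (inter_mem hV (hΩ.mem_nhds hx)) (Metric.eball_mem_nhds x (by simpa using hη0))), ?_⟩
  obtain ⟨N, hN⟩ := (Metric.tendsto_atTop.1 (hU x hx)) (ε / 2) (half_pos hε)
  filter_upwards [eventually_ge_atTop N] with n hn y hy
  obtain ⟨⟨hyV, hyΩ⟩, hyball⟩ := hy
  have hxy : edist x y ≤ ENNReal.ofReal η := by
    rw [edist_comm]; exact (Metric.mem_eball.1 hyball).le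
  have h1 : |U x - U y| ≤ K * η :=
    abs_sub_le_of_lipschitzOnWith hUK ⟨hxV, hx⟩ ⟨hyV, hyΩ⟩ hη0.le hxy
  have h2 : |u (φ n) x - u (φ n) y| ≤ K * η :=
    abs_sub_le_of_lipschitzOnWith (hK (φ n)) hxV hyV hη0.le hxy
  have h3 : |u (φ n) x - U x| < ε / 2 := by
    have := hN n hn; rwa [Real.dist_eq] at this
  rw [Real.dist_eq]
  calc |U y - u (φ n) y| ≤ |U y - U x| + |U x - u (φ n) x| + |u (φ n) x - u (φ n) y| := by
        calc |U y - u (φ n) y| ≤ |U y - u (φ n) x| + |u (φ n) x - u (φ n) y| := abs_sub_le _ _ _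
          _ ≤ |U y - U x| + |U x - u (φ n) x| + |u (φ n) x - u (φ n) y| := by
              gcongr; exact abs_sub_le _ _ _
    _ < ε := by rw [abs_sub_comm (U y) (U x), abs_sub_comm (U x) (u (φ n) x)]; linarith

end Literature.Geometry.Lorentzian

end
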